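import Summits.ValiantsHypothesis.ValiantsHypothesis.Theorems.LacunarySymmetroidMatrixDescartesOverlapSector

/-!
# `MatrixDescartes` — the overlap sector with LOGARITHMIC live width: monsters need more than `log₂ K` live letters

HONEST FRAMING.  Object-search cell `pub-symmetroid`, crux `Theses.LacunarySymmetroid.MatrixDescartes` (ledger item
`stmt-ValiantsHypothesis-18050`, route `LacunarySymmetroid`; seat `val-sym-mdr-p2`, gen 13).  The crux implies `VP ≠ VNP`
by the route's assembly; NOTHING here is progress on it, and nothing here is a claim about `VP ≠ VNP`, `DoorA26` /
`DoorA34` or the cell's registers.  Sequel of `…OverlapSector` (`Overlap.overlapSector_mdr`: fixed cut budget `(m+w)^w`).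

THIS FILE lets the width grow with the format: in the crux's regime `m ≤ 2^((⌊log₂K⌋+c)^c)` a count
`Z ≤ 2K(m+w)^w + 1` with `w ≤ ⌊log₂ K⌋` still satisfies `Z^q ≤ 2^(K⌊log₂K⌋)` for `K ≥ K₀(c, q)` (`sector_absorb_log`:
`log₂ Z ≤ L + 2 + L((L+c)^c + L) ≤ (L + c + 4)^(c+4)`, absorbed by the tree's `stub_arith4`).  Hence
(`overlapSector_mdr_log`): every real lacunary pencil admitting a live-set cover (`card_posRoots_le_of_liveCover`) with
`N ≤ K` windows of cut budget `#(A j) ≤ (m + w)^w`, `w ≤ ⌊log₂ K⌋` — e.g. live sets of at most `⌊log₂K⌋ + 1` letters with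
the canonical cuts — satisfies the inequality of `MatrixDescartes`, eventually in `K`.  READING: a pencil violating the crux
in its own size window has, at some scale, MORE THAN `⌊log₂ K⌋ + 1` letters simultaneously live (in the weighted sense of
the window law).  A SECTOR theorem; nothing is claimed about such wide overlaps.  [folklore] (counting).
-/

-- `Summit.ValiantsHypothesis.ValiantsHypothesis.…` repeats a component by the D-0017 layout (single-conjunct summit).
set_option linter.dupNamespace false

namespace Summit.ValiantsHypothesis.ValiantsHypothesis.Theorems.LacunarySymmetroidMatrixDescartes.Overlap

open Polynomial Finset Set
open scoped BigOperators Matrix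

variable {K m : ℕ}

/-! ## §11 Logarithmic width -/

/-- **Regime arithmetic, logarithmic width.**  In the regime `m ≤ 2^((⌊log₂K⌋+c)^c)`, a count `Z ≤ 2K(m+w)^w + 1` with
`w ≤ ⌊log₂ K⌋` satisfies `Z^q ≤ 2^(K⌊log₂K⌋)` for `K ≥ K₀(c, q)`. [folklore] -/
theorem sector_absorb_log (c q : ℕ) : ∃ K₀ : ℕ, ∀ K m Z w : ℕ, K₀ ≤ K → m ≤ 2 ^ ((Nat.log 2 K + c) ^ c) →
    w ≤ Nat.log 2 K → Z ≤ 2 * (K * (m + w) ^ w) + 1 → Z ^ q ≤ 2 ^ (K * Nat.log 2 K) := by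
  obtain ⟨K₁, hK₁⟩ := stub_arith4 (c + 4) q
  refine ⟨K₁, fun K m Z w hK hm hw hZ => hK₁ K Z hK ?_⟩
  set Lg := Nat.log 2 K with hLg
  set B := Lg + (c + 4) with hB
  have hK2 : K < 2 ^ (Lg + 1) := Nat.lt_pow_succ_log_self one_lt_two K
  have h2K : 2 * K + 1 ≤ 2 ^ (Lg + 2) := by rw [pow_succ]; omega
  have hmw : m + w ≤ 2 ^ ((Lg + c) ^ c + w) := by
    have ha : 1 ≤ 2 ^ ((Lg + c) ^ c) := Nat.one_le_two_pow
    have hw2 : w + 1 ≤ 2 ^ w := Nat.lt_two_pow_self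
    calc m + w ≤ 2 ^ ((Lg + c) ^ c) + w := Nat.add_le_add_right hm w
      _ ≤ 2 ^ ((Lg + c) ^ c) * (w + 1) := by nlinarith
      _ ≤ 2 ^ ((Lg + c) ^ c) * 2 ^ w := Nat.mul_le_mul_left _ hw2
      _ = 2 ^ ((Lg + c) ^ c + w) := by rw [← pow_add]
  have hpow : (m + w) ^ w ≤ 2 ^ (Lg * ((Lg + c) ^ c + Lg)) := by
    calc (m + w) ^ w ≤ (2 ^ ((Lg + c) ^ c + w)) ^ w := Nat.pow_le_pow_left hmw w
      _ = 2 ^ (w * ((Lg + c) ^ c + w)) := by rw [← pow_mul, mul_comm]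
      _ ≤ 2 ^ (Lg * ((Lg + c) ^ c + Lg)) :=
          Nat.pow_le_pow_right (by norm_num) (Nat.mul_le_mul hw (Nat.add_le_add_left hw _))
  have h1pow : 1 ≤ (m + w) ^ w := by
    rcases Nat.eq_zero_or_pos w with hw0 | hw0
    · rw [hw0, pow_zero]
    · exact Nat.one_le_pow _ _ (by omega)
  have hZ' : Z ≤ 2 ^ (Lg + 2 + Lg * ((Lg + c) ^ c + Lg)) := by
    calc Z ≤ 2 * (K * (m + w) ^ w) + 1 := hZ
      _ ≤ (2 * K + 1) * (m + w) ^ w := by nlinarith [h1pow]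
      _ ≤ 2 ^ (Lg + 2) * 2 ^ (Lg * ((Lg + c) ^ c + Lg)) := Nat.mul_le_mul h2K hpow
      _ = 2 ^ (Lg + 2 + Lg * ((Lg + c) ^ c + Lg)) := by rw [← pow_add]
  have hB3 : 3 ≤ B := by omega
  have hB1 : 1 ≤ B := by omega
  have hE1 : Lg + 2 ≤ B ^ (c + 2) := (by omega : Lg + 2 ≤ B).trans (Nat.le_self_pow (by omega) B)
  have hE2 : Lg * (Lg + c) ^ c ≤ B ^ (c + 2) := by
    have hLB : Lg ≤ B := by omega
    have hc : (Lg + c) ^ c ≤ B ^ (c + 1) :=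
      (Nat.pow_le_pow_left (by omega) c).trans (Nat.pow_le_pow_right hB1 (by omega))
    calc Lg * (Lg + c) ^ c ≤ B * B ^ (c + 1) := Nat.mul_le_mul hLB hc
      _ = B ^ (c + 2) := by rw [← pow_succ']
  have hE3 : Lg * Lg ≤ B ^ (c + 2) := by
    have hLB : Lg ≤ B := by omega
    calc Lg * Lg ≤ B * B := Nat.mul_le_mul hLB hLB
      _ = B ^ 2 := (pow_two B).symm
      _ ≤ B ^ (c + 2) := Nat.pow_le_pow_right hB1 (by omega)
  have hE : Lg + 2 + Lg * ((Lg + c) ^ c + Lg) ≤ B ^ (c + 4) := by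
    calc Lg + 2 + Lg * ((Lg + c) ^ c + Lg) = (Lg + 2) + Lg * (Lg + c) ^ c + Lg * Lg := by ring
      _ ≤ B ^ (c + 2) + B ^ (c + 2) + B ^ (c + 2) := by omega
      _ = 3 * B ^ (c + 2) := by ring
      _ ≤ B * B ^ (c + 2) := Nat.mul_le_mul_right _ hB3
      _ = B ^ (c + 3) := by rw [← pow_succ']
      _ ≤ B ^ (c + 4) := Nat.pow_le_pow_right hB1 (by omega)
  calc Z ≤ 2 ^ (Lg + 2 + Lg * ((Lg + c) ^ c + Lg)) := hZ'
    _ ≤ 2 ^ (B ^ (c + 4)) := Nat.pow_le_pow_right (by norm_num) hE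
    _ = 2 ^ ((Nat.log 2 K + (c + 4)) ^ (c + 4)) := by rw [hB, hLg]

/-- **The crux's inequality on the overlap sector with logarithmic live width.**  For all `c, q` there is `K₀` such that for
`K ≥ K₀`, `m ≤ 2^((⌊log₂K⌋+c)^c)` and EVERY real `m × m` lacunary pencil (symmetric or not) admitting a live-set cover
(`card_posRoots_le_of_liveCover`) with `N ≤ K` windows of cut budget `#(A j) ≤ (m + w)^w` where `w ≤ ⌊log₂ K⌋` — e.g. live
sets of at most `⌊log₂ K⌋ + 1` letters with the canonical cuts (`C(#L + m − 1, m) − 1 ≤ (m + w)^w`) — the number `Z` of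
distinct real zeros of `det F` satisfies `Z^q ≤ 2^(K⌊log₂K⌋)`.  Reading: a pencil violating `MatrixDescartes` in its own
size window has, at some scale, more than `⌊log₂ K⌋ + 1` letters simultaneously live, eventually in `K`. [folklore] -/
theorem overlapSector_mdr_log (c q : ℕ) : ∃ K₀ : ℕ, ∀ K m : ℕ, K₀ ≤ K → m ≤ 2 ^ ((Nat.log 2 K + c) ^ c) →
    ∀ (d : Fin K → ℕ) (S : Fin K → Matrix (Fin m) (Fin m) ℝ) (N : ℕ) (p : Fin (N + 1) → ℝ),
      0 < p 0 → Monotone p →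
    ∀ (L : Fin N → Finset (Fin K)) (t : Fin N → Fin K) (A : Fin N → Finset ℕ), (∀ j, t j ∈ L j) →
      (∀ j, ∀ f : Fin m → Fin K, (∀ i, f i ∈ L j) → (∃ i, f i ≠ t j) → (∑ i, d (f i)) ∈ A j) →
      (∀ j, ∀ x : ℝ, (x = p j.castSucc ∨ x = p j.succ) →
        ∑ f ∈ Finset.univ.filter (fun f : Fin m → Fin K => ¬ ∀ i, f i ∈ L j),
          (∏ a ∈ A j, |((∑ i, d (f i) : ℕ) : ℝ) - a|) * |Matrix.det (Matrix.of fun i j => S (f i) i j)| *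
            x ^ (∑ i, d (f i))
        < (∏ a ∈ A j, |((m * d (t j) : ℕ) : ℝ) - a|) * |(S (t j)).det| * x ^ (m * d (t j))) →
    ∀ (b τ : Fin K), (∀ l, l ≠ b → d b < d l) → (∀ l, l ≠ τ → d l < d τ) →
      (∑ f ∈ Finset.univ.erase (fun _ : Fin m => b),
        |Matrix.det (Matrix.of fun i j => S (f i) i j)| * (p 0) ^ (∑ i, d (f i)) < |(S b).det| * (p 0) ^ (m * d b)) →
      (∑ f ∈ Finset.univ.erase (fun _ : Fin m => τ),
        |Matrix.det (Matrix.of fun i j => S (f i) i j)| * (p (Fin.last N)) ^ (∑ i, d (f i))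
        < |(S τ).det| * (p (Fin.last N)) ^ (m * d τ)) →
    ∀ w : ℕ, w ≤ Nat.log 2 K → N ≤ K → (∀ j, (A j).card ≤ (m + w) ^ w) →
      (Matrix.det (∑ l, ((X : ℝ[X]) ^ d l) • (S l).map C)).roots.toFinset.card ^ q ≤ 2 ^ (K * Nat.log 2 K) := by
  obtain ⟨K₀, hK₀⟩ := sector_absorb_log c q
  refine ⟨K₀, fun K m hK hm d S N p hp0 hmono L t A ht hA hwin b τ hb hτ hbot htop w hw hN hAcard =>
    hK₀ K m _ w hK hm hw ?_⟩
  have h := card_realRoots_le_of_liveCover d S p hp0 hmono L t ht A hA hwin b τ hb hτ hbot htop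
  have hsum : ∑ j, (A j).card ≤ N * (m + w) ^ w := by
    calc ∑ j, (A j).card ≤ ∑ _j : Fin N, (m + w) ^ w := Finset.sum_le_sum fun j _ => hAcard j
      _ = N * (m + w) ^ w := by rw [Finset.sum_const, Finset.card_univ, Fintype.card_fin, smul_eq_mul]
  have hNK : N * (m + w) ^ w ≤ K * (m + w) ^ w := Nat.mul_le_mul_right _ hN
  omega

end Summit.ValiantsHypothesis.ValiantsHypothesis.Theorems.LacunarySymmetroidMatrixDescartes.Overlap
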